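import Literature.Probability.RandomPlanarGeometry.RetargetMoebius
import Literature.Probability.RandomPlanarGeometry.SLEStoppedCurveEvents
import Literature.Probability.RandomPlanarGeometry.CurveMonotoneReparam
import HarnessLib

/-!
# The half-plane form of the splitting property (target independence) of chordal SLE₆

Topic `Probability/RandomPlanarGeometry`. G. F. Lawler, *Conformally Invariant Processes in the
Plane* (2005), §6.3: Thm. 6.13 (locality: for `κ = 6` the conformal image `γ* = Φ ∘ γ` of the SLE₆
trace is a time change of SLE₆ up to the exit of `Φ(𝒩̂)` — the Itô computation
`dU*_t = (κ/2 − 3) Φ_t''(U_t) dt + √κ Φ_t'(U_t) dB_t`, driftless at `κ = 6`) and its application to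
the Möbius map `Φ_x(z) = zx/(z+x)` (paragraph before Prop. 6.14), which is Prop. 6.14 — "chordal
SLE₆ from `z` to `w` and from `z` to `w'` have the same distribution up to the first time they reach
the arc of `∂D` between `w` and `w'` not containing `z`" — for the three-marked half-plane
`(ℍ; 0, x, ∞)`; equivalently Lawler–Schramm–Werner (2001), Cor. 2.3 / Werner (2007), Prop. 3.4
in `ℍ`.

Contents:
* `stoppedPathClass F γ τ` — the curve class (curve modulo reparametrisation) of the stopped image
  path `s ↦ F (γ (τ s))`, `s ∈ [0, 1]` (documented junk when discontinuous);
* `mk_stopAt_eq_stoppedPathClass` — PROVED: stopping the time-compactified image `c` of a path `γ`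
  under `Ψ` (`IsCompactifiedImage`, the form in which chordal SLE curves are given, `IsSLECurve`) at
  its first hitting of a closed set `F` pulling back along `γ` to the closed set `S` yields the class
  of the stopped image path `Ψ ∘ γ|[0, τ]`, `τ = firstHit γ S` (hitting parameter `τ/(1+τ)`; two
  monotone traversals of one arc, `Curve.reparamDist_eq_zero_of_monotone'`);
* `sle_six_moebius_locality` — NAMED FACT (Lawler Thm. 6.13 / Prop. 6.14 in `ℍ`): for `x ≠ 0` the
  classes of `Φ_x ∘ γ|[0, T₋]` and `γ|[0, T₊]` have the same law, `γ` the SLE₆ trace,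
  `T₊ = firstHit γ (realRay x)`, `T₋ = firstHit γ (realRay (-x))` (the closed ray from the pole
  `-x = Φ_x⁻¹(∞)`, i.e. the pull-back of the arc `[x, ∞] ∌ 0`, `retargetMoebius.mem_realRay_iff`).

The reduction of the Jordan-domain statement `IsSLELaw.targetIndependence_six`
(`SLESixSplitting.lean`) to `sle_six_moebius_locality` is `SLESixSplittingReduction.lean`. What is
NOT here: the proof of the half-plane fact (Itô's formula for `Φ_t(U_t)`, Lawler (4.35), the
random time change `∫ Φ_s'(U_s)² ds` and the identification in law of the time-changed driving
function with `√6 B`).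

## References

* G. F. Lawler, *Conformally Invariant Processes in the Plane*, AMS (2005), §6.3, Thm. 6.13,
  Prop. 6.14; Rem. 6.6. [Lawler2005]
* G. F. Lawler, O. Schramm, W. Werner, Acta Math. 187 (2001), Thm. 2.2, Cor. 2.3.
  [LawlerSchrammWerner2001]
* W. Werner, *Lectures on two-dimensional critical percolation* (2007), Prop. 3.4. [Werner2007]
-/

noncomputable section

open Set Filter Topology MeasureTheory Complex
open UpperHalfPlane (upperHalfPlaneSet)
open scoped NNReal unitInterval

namespace Literature.Probability.RandomPlanarGeometry

/-! ### The class of a stopped (image) path -/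

/-- **The curve class of the stopped image path** `s ↦ F(γ(τ s))`, `s ∈ [0, 1]` (the initial piece
`γ[0, τ]` of a half-infinite path, pushed forward by `F`, modulo reparametrisation), with the
documented junk value `mk (const 0)` when `s ↦ F(γ(τ s))` is not continuous (for `F = Φ_x` and
the SLE trace this only happens if the trace visits the pole `-x` before `τ`, a null event).
[folklore] -/
def stoppedPathClass (F : ℂ → ℂ) (γ : ℝ≥0 → ℂ) (τ : ℝ≥0) : CurveClass ℂ := by
  classical
  exact
  if h : Continuous (fun s : I ↦ F (γ ((τ : ℝ) * s).toNNReal)) then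
    CurveClass.mk ⟨⟨fun s : I ↦ F (γ ((τ : ℝ) * s).toNNReal), h⟩⟩
  else CurveClass.mk (Curve.const 0)

/-- On the continuous branch, `stoppedPathClass` is the class of the stopped image path.
[folklore] -/
theorem stoppedPathClass_eq {F : ℂ → ℂ} {γ : ℝ≥0 → ℂ} {τ : ℝ≥0}
    (h : Continuous (fun s : I ↦ F (γ ((τ : ℝ) * s).toNNReal))) :
    stoppedPathClass F γ τ = CurveClass.mk ⟨⟨fun s : I ↦ F (γ ((τ : ℝ) * s).toNNReal), h⟩⟩ := by
  classical
  unfold stoppedPathClass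
  rw [dif_pos h]

/-- For a continuous path and `F = id` the branch is always the continuous one. [folklore] -/
theorem continuous_stoppedPath_id {γ : ℝ≥0 → ℂ} (hγ : Continuous γ) (τ : ℝ≥0) :
    Continuous (fun s : I ↦ id (γ ((τ : ℝ) * s).toNNReal)) :=
  hγ.comp (continuous_real_toNNReal.comp (continuous_const.mul continuous_subtype_val))

/-! ### Stopping a time-compactified image at a pulled-back closed set -/

/-- The clamp `r ↦ max 0 (min 1 r)` of `ℝ` onto `[0, 1]` is continuous. [folklore] -/
theorem continuous_clampUnit : Continuous fun r : ℝ ↦ max 0 (min 1 r) :=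
  continuous_const.max (continuous_const.min continuous_id)

/-- The clamp `r ↦ max 0 (min 1 r)` is monotone. [folklore] -/
theorem monotone_clampUnit : Monotone fun r : ℝ ↦ max 0 (min 1 r) :=
  fun _ _ hab ↦ max_le_max le_rfl (min_le_min le_rfl hab)

/-- On `[0, 1]` the clamp is the identity. [folklore] -/
theorem clampUnit_of_mem (t : I) : max 0 (min 1 (t : ℝ)) = t := by
  rw [min_eq_right t.2.2, max_eq_right t.2.1]

/-- **Stopping a time-compactified image at a pulled-back closed set.** Let `c` be the
time-compactified image of the continuous path `γ` under `Ψ` (end point `b`), let the closed set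
`F` pull back along `γ` to the closed set `S` (`Ψ (γ t) ∈ F ↔ γ t ∈ S`), and let `γ` first hit
`S` at the finite time `τ`. If `t ↦ Ψ (γ t)` is continuous on `[0, τ]`, then the class of `c`
stopped at its first hitting of `F` is the class of the stopped image path `s ↦ Ψ (γ (τ s))`
(`stoppedPathClass Ψ γ τ`): the hitting parameter of `c` is `σ = τ/(1+τ)` (`rayParam σ = τ`),
and `s ↦ c (σ s) = Ψ (γ (rayParam (σ s)))` and `s ↦ Ψ (γ (τ s))` are two monotone traversals of
the same arc (`Curve.reparamDist_eq_zero_of_monotone'`). [folklore] -/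
theorem mk_stopAt_eq_stoppedPathClass {Ψ : ℂ → ℂ} {γ : ℝ≥0 → ℂ} {b : ℂ} {c : Curve ℂ}
    {F S : Set ℂ} (hF : IsClosed F) (hS : IsClosed S) (hγ : Continuous γ)
    (hΨF : ∀ t, Ψ (γ t) ∈ F ↔ γ t ∈ S) (hc : IsCompactifiedImage Ψ γ b c)
    {τ : ℝ≥0} (hτ : firstHit γ S = τ)
    (hcont : ContinuousOn (fun t : ℝ ↦ Ψ (γ t.toNNReal)) (Icc 0 τ)) :
    CurveClass.mk (c.stopAt F) = stoppedPathClass Ψ γ τ := by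
  -- `γ τ ∈ S`
  obtain ⟨t₀, ht₀, hγt₀⟩ := exists_firstHit_eq_coe hγ hS (by rw [hτ]; exact WithTop.coe_ne_top)
  obtain rfl : t₀ = τ := WithTop.coe_injective (ht₀.symm.trans hτ)
  -- the hitting parameter `sσ`
  obtain ⟨sσ, hsσ1, hsσ⟩ := exists_rayParam_eq t₀
  have hcF : ∀ s : I, (s : ℝ) < 1 → (c s ∈ F ↔ γ (rayParam s) ∈ S) := fun s hs ↦ by
    rw [hc.1 s hs, hΨF]
  have hhit : c.hitParam F = sσ := by
    refine le_antisymm (Curve.hitParam_le ((hcF sσ hsσ1).2 (hsσ ▸ hγt₀))) ?_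
    refine CurveClass.coe_le_hitParam_of_forall_lt_notMem hF fun r hr hrF ↦ ?_
    have hr1 : (r : ℝ) < 1 := lt_trans (Subtype.coe_lt_coe.2 hr) hsσ1
    have h1 : (t₀ : WithTop ℝ≥0) ≤ rayParam r := hτ ▸ firstHit_le ((hcF r hr1).1 hrF)
    have h2 : rayParam r < rayParam sσ := (rayParam_lt_rayParam_iff hr1 hsσ1).2 hr
    rw [hsσ] at h2
    exact absurd (WithTop.coe_le_coe.1 h1) (not_le.2 h2)
  -- the stopped curve pointwise
  have hsσ0 : 0 ≤ (sσ : ℝ) := sσ.2.1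
  have hmemI : ∀ s : I, (sσ : ℝ) * s ∈ Icc (0 : ℝ) 1 := fun s ↦
    ⟨mul_nonneg hsσ0 s.2.1, (mul_le_of_le_one_right hsσ0 s.2.2).trans sσ.2.2⟩
  have hlt1 : ∀ s : I, (sσ : ℝ) * s < 1 := fun s ↦ (mul_le_of_le_one_right hsσ0 s.2.2).trans_lt hsσ1
  have hstop : ∀ s : I, c.stopAt F s = Ψ (γ (rayParam ⟨(sσ : ℝ) * s, hmemI s⟩)) := fun s ↦ by
    rw [Curve.stopAt_apply, hhit, projIcc_of_mem _ (hmemI s), hc.1 _ (hlt1 s)]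
  -- the linear traversal is continuous
  have hcont' : Continuous (fun s : I ↦ Ψ (γ (((t₀ : ℝ≥0) : ℝ) * s).toNNReal)) := by
    have hmaps : ∀ s : I, ((t₀ : ℝ) * s) ∈ Icc (0 : ℝ) t₀ := fun s ↦
      ⟨mul_nonneg t₀.2 s.2.1, mul_le_of_le_one_right t₀.2 s.2.2⟩
    exact hcont.comp_continuous (continuous_const.mul continuous_subtype_val) hmaps
  rw [stoppedPathClass_eq hcont', CurveClass.mk_eq_mk]
  -- two monotone traversals of `V = Ψ ∘ γ` on `[0, τ]`
  set q : ℝ → ℝ := fun r ↦ max 0 (min 1 r) with hq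
  have hq01 : ∀ r, q r ∈ Icc (0 : ℝ) 1 := fun r ↦
    ⟨le_max_left _ _, max_le zero_le_one (min_le_left _ _)⟩
  have hsσq1 : ∀ r, (sσ : ℝ) * q r < 1 := fun r ↦ (mul_le_of_le_one_right hsσ0 (hq01 r).2).trans_lt hsσ1
  have hsσq0 : ∀ r, 0 ≤ (sσ : ℝ) * q r := fun r ↦ mul_nonneg hsσ0 (hq01 r).1
  set h₁ : ℝ → ℝ := fun r ↦ (sσ : ℝ) * q r / (1 - sσ * q r) with hh₁
  set h₂ : ℝ → ℝ := fun r ↦ (t₀ : ℝ) * q r with hh₂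
  have hτsσ : ((t₀ : ℝ≥0) : ℝ) = (sσ : ℝ) / (1 - sσ) := by
    rw [← hsσ, coe_rayParam]
  refine Curve.reparamDist_eq_zero_of_monotone' (m := (t₀ : ℝ)) t₀.2 hcont (h₁ := h₁) (h₂ := h₂)
    ?_ ?_ ?_ ?_ ?_ ?_ ?_ ?_ ?_ ?_
  · exact ((continuous_const.mul continuous_clampUnit).div
      (continuous_const.sub (continuous_const.mul continuous_clampUnit)) fun r ↦ by
        have := hsσq1 r; linarith)
  · exact continuous_const.mul continuous_clampUnit
  · intro a b hab
    have hqab : q a ≤ q b := monotone_clampUnit hab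
    simp only [hh₁]
    rw [div_le_div_iff₀ (by linarith [hsσq1 a]) (by linarith [hsσq1 b])]
    nlinarith [hsσq0 a, hsσq0 b, hsσq1 a, hsσq1 b, mul_le_mul_of_nonneg_left hqab hsσ0]
  · exact fun a b hab ↦ mul_le_mul_of_nonneg_left (monotone_clampUnit hab) t₀.2
  · simp [hh₁, hq]
  · simp [hh₂, hq]
  · simp only [hh₁, hq]
    rw [min_self, max_eq_right zero_le_one, mul_one, hτsσ]
  · simp only [hh₂, hq]
    rw [min_self, max_eq_right zero_le_one, mul_one]
  · intro t
    rw [hstop t]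
    simp only [hh₁, hq, clampUnit_of_mem t]
    congr 2
    ext
    have hnn : 0 ≤ (sσ : ℝ) * t / (1 - sσ * t) :=
      div_nonneg (mul_nonneg hsσ0 t.2.1) (by linarith [hlt1 t])
    rw [coe_rayParam, Real.coe_toNNReal _ hnn]
  · intro t
    simp only [hh₂, hq, clampUnit_of_mem t]
    rfl

/-! ### The half-plane form of target independence (Lawler (2005), §6.3) -/

/-- NAMED FACT — **Möbius images of chordal SLE₆ are chordal SLE₆ up to the disconnection time**
(Lawler (2005), §6.3: Thm. 6.13 (locality: "If `κ = 6`, then `γ*(s)` is a time change of SLE₆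
stopped at the first time it leaves `Φ(𝒩̂)`") applied, as in the paragraph before Prop. 6.14, to
the Möbius map `Φ(z) = zx/(z+x)`: "Suppose `γ*(t)` is SLE₆ in `ℍ` connecting `0` and `x` … We can
construct this by `Φ ∘ γ(t)` … for `t < t₀`, `γ*(t)` is a time change of SLE₆. After time `t₀` the
two curves … evolve differently; `γ` heads toward infinity while `γ*` heads toward `x`"; this is
Prop. 6.14 — "chordal SLE₆ from `z` to `w` and chordal SLE₆ from `z` to `w'` … have the same
distribution up to the first time they reach the arc of `∂D` between `w` and `w'` not containing
`z`" — for the three-marked half-plane `(ℍ; 0, x, ∞)`). Transcribed on the canonical space: for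
real `x ≠ 0` let `γ` be the SLE₆ trace (`sleTrace 6 ω`, from `0` to `∞`) and `Φ_x ∘ γ`
(`retargetMoebius x`) the SLE₆ from `0` to `x`. The arc of `∂ℍ` between `x` and `∞` not
containing `0` is the closed real ray from `x` away from `0` (`realRay x`, with `∞`); `γ` reaches
it at `T₊ = firstHit γ (realRay x)`, and `Φ_x ∘ γ` reaches it exactly when `γ` reaches
`Φ_x⁻¹([x, ∞]) = realRay (-x)` (the closed ray from the pole `-x = Φ_x⁻¹(∞)`,
`retargetMoebius.mem_realRay_iff`), at `T₋ = firstHit γ (realRay (-x))`. Statement: the curve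
classes (curves modulo reparametrisation, `stoppedPathClass`) of `Φ_x ∘ γ|[0, T₋]` and of
`γ|[0, T₊]` have the same law under the pre-Wiener measure (both times are a.s. finite for
`κ = 6 > 4`, Lawler Prop. 6.8; junk `0` on the null event where they are not).
[cite: Lawler2005, §6.3, Thm. 6.13 and Prop. 6.14] -/
def sle_six_moebius_locality : Prop :=
  ∀ (x : ℝ), x ≠ 0 → ∀ T : Set (CurveClass ℂ), MeasurableSet T →
    Process.preWienerMeasure {ω | stoppedPathClass (retargetMoebius x) (sleTrace 6 ω)
        ((firstHit (sleTrace 6 ω) (realRay (-x))).untopD 0) ∈ T} =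
      Process.preWienerMeasure {ω | stoppedPathClass id (sleTrace 6 ω)
        ((firstHit (sleTrace 6 ω) (realRay x)).untopD 0) ∈ T}

end Literature.Probability.RandomPlanarGeometry

end
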